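import Summits.HodgeConjecture.HodgeConjecture.Theorems.EndoscopicMiddleDegreeOrthogonalEnvelopedLevelCoverCompactT2
import Summits.HodgeConjecture.HodgeConjecture.Theorems.EndoscopicMiddleDegreeOrthogonalEnvelopedCoverMapHolomorphic
import Summits.HodgeConjecture.HodgeConjecture.Theorems.EndoscopicMiddleDegreeOrthogonalEnvelopedLevelCoverKaehler
import Summits.HodgeConjecture.HodgeConjecture.Theorems.EndoscopicMiddleDegreeOrthogonalEnvelopedModelKaehlerCompact
import Summits.HodgeConjecture.HodgeConjecture.Theorems.EndoscopicMiddleDegreeOrthogonalEnvelopedHodgeTypeDescent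
import Summits.HodgeConjecture.HodgeConjecture.Theorems.EndoscopicMiddleDegreeOrthogonalEnvelopedHeckeGraphAnalytic
import Literature.Geometry.Manifold.CoveringSpaceManifold
import Literature.NumberTheory.Transcendental.ComplexFormsPullback
import Literature.AlgebraicTopology.SingularHomology.FreeActionLefschetzNumber
import Literature.AlgebraicGeometry.HodgeTheory.HodgeTypeConjugation

/-!
# Hecke operators of compact ball quotients preserve Hodge types — UNCONDITIONALLY
# (crux `EndoscopicMiddleDegree.OrthogonalEnveloped`, stmt-HodgeConjecture-14300, line `purity-sorted-hecke-envelope`, lead seat c6)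

The Hodge-type stability of the Hecke algebra `𝓗 = Algebra.adjoin ℂ (range T_g)` of a compact ball quotient
`X(ℂ) ≅ Γ \ 𝔹` — the hypothesis `hH` of the landed coefficient-conjugation sieve `stub_killedBarren` (p96373) — was
so far available only GRANTED Grothendieck's coniveau remark (`HeckeGraphChow.isOfHodgeType_heckeCorrespondenceAction`,
p111880: `T_g` is the action of an ALGEBRAIC class, and algebraic classes are of type `(s,s)`). This file proves it
with NO named fact, analytically (Shimura: the projections of a modular correspondence are holomorphic; Voisin I
§7.3.2: holomorphic pull-backs are morphisms of Hodge structures):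

* `T_g = [Γ':N]⁻¹ τ ∘ π_g^*` on the level cover `π : N \ 𝔹 → X(ℂ)`, with `π^* T_g x = [Γ':N]⁻¹ Σ_q (π_g ∘ q)^* x`
  (`levelProj_map_heckeCorrespondenceAction`, Literature, proved);
* the complex structure of a Hodge model `A` of `X` LIFTS to `N \ 𝔹` along the covering
  (`Literature.Geometry.Manifold.liftChartedSpace`, `isManifold_of_atlas_eq_lift`, Lee Prop. 4.40, proved), the level
  cover is compact Hausdorff (`stub_levelCoverCompactT2`) and Kähler (`stub_levelCoverKaehler`, pulling back a Kähler
  metric of the compact Kähler `A.carrier`, `stub_modelKaehlerCompact`), and every branch `N[v] ↦ Γ[g γ v]` is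
  holomorphic (`stub_coverMapHolomorphic`);
* holomorphic pull-backs preserve `H^{p,q}` (`map_mem_hodgePQ`) and the comparison `A.deRham` is natural, so
  `π^* (φ^* T_g β)` lies in `A.deRham (H^{p,q}(N \ 𝔹))`; Hodge types DESCEND along the injective `π^*`
  (`stub_hodgeTypeDescent`: both sides carry the Hodge decomposition `Motives.isInternal_hodgePQ_holds`, PROVED in the
  tree; `π^*` injective by the transfer, `map_proj_injective_of_card_ne_zero`).

Results: `isOfHodgeType_heckeCorrespondenceAction_analytic` (every `T_g`, every degree, every `(p,q)`) and
`heckeHodgeType` (the whole Hecke algebra on `H^{2(m+1)}`), replacing the registered named-fact stub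
`stub_grothendieckConiveau` of the line. References: Shimura 1971 §8.3 and Ch. 7; BMM arXiv:1306.1515 Part 2 §1.8,
Thm. 61; Voisin 2002 §7.3.2; Lee 2012 Prop. 4.40.
-/

noncomputable section

-- The crux-workfile namespace `Summit.<P>.<Sub>.Cruxes.…` repeats `HodgeConjecture` (single-conjunct summit).
set_option linter.dupNamespace false

namespace Summit.HodgeConjecture.HodgeConjecture.Cruxes.OrthogonalEnveloped.PuritySortedHeckeEnvelope

open scoped BigOperators Manifold ContDiff
open CategoryTheory MonoidalCategory CartesianMonoidalCategory
open Literature.AlgebraicGeometry.Motives (SchemeOver ComplexPoints IsSmoothProjective)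
open Literature.AlgebraicGeometry.HodgeTheory
open Literature.AlgebraicGeometry.ShimuraVarieties
open Literature.AlgebraicTopology.SingularHomology
open Literature.NumberTheory.Transcendental (ComplexDeRhamIsoFamily complexDeRhamCohomology hodgePQ
  map_mem_hodgePQ)
open Literature.Geometry.Manifold (liftChartedSpace coveringPiece isManifold_of_atlas_eq_lift
  contMDiff_proj_of_chartAt_eq)
open Literature.Geometry.Kaehler (IsKaehlerManifold)
open Summit.HodgeConjecture.HodgeConjecture.Cruxes.OrthogonalEnveloped.HeckeGraphChow
  (stub_properlyDiscontinuous isCancelSMul_ball stub_ballLocallyCompactT2)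

/-! ## The Hecke operators preserve Hodge types — UNCONDITIONALLY (assembly of the landed Stubs L1–L5) -/

/-- **The Hecke operators preserve every Hodge type** (no named fact). For a compact ball quotient datum
`D` on `X`, any `g` and any class `β ∈ Hᵏ(X(ℂ); ℂ)` of type `(p', q')`, `T_g β` is of type `(p', q')`:
`T_g = 0` off the admissible locus; for admissible `g`, read in the Hodge model `A` witnessing the type of `β`,
`pL^* (φ^* T_g β) = π^* T_g β = [Γ':N]⁻¹ Σ_q (π_g ∘ q)^* β` (`levelProj_map_heckeCorrespondenceAction`) is a sum
of pull-backs of `φ^* β` along the HOLOMORPHIC branches `φ⁻¹ ∘ π_g ∘ q = φ⁻¹ ∘ coverMap (g γ)`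
(`twist_comp_smul`, Stub L2), hence lies in `e_L(H^{p',q'}(N \ 𝔹))` (`map_mem_hodgePQ`, naturality of
`A.deRham`), and descends (Stub L5 on the compact Kähler `N \ 𝔹`, Stubs L1/L3/L4; `π^*` injective by
`map_proj_injective_of_card_ne_zero`). [cite: Shimura1973, §8.3] [cite: BergeronMillsonMoeglin2016Balls, Part 2 §1.8 and Thm. 61]
[cite: VoisinHodgeI2002, §7.3.2] -/
theorem isOfHodgeType_heckeCorrespondenceAction_analytic {p : ℕ} {X : SchemeOver ℂ}
    (D : UnitaryBallQuotientDatum p X) (g : GL (Fin (p + 1)) D.E) {k p' q' : ℕ}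
    {β : complexBetti X k} (hβ : IsOfHodgeType p X k p' q' β) :
    IsOfHodgeType p X k p' q' (D.heckeCorrespondenceAction k g β) := by
  obtain ⟨A, hA⟩ := hβ
  by_cases h : D.IsHeckeAdmissible g
  swap
  · rw [D.heckeCorrespondenceAction_of_not h, LinearMap.zero_apply]
    exact IsOfHodgeType.zero A k p' q'
  haveI : (D.heckeLevel g).FiniteIndex := h.finiteIndex
  letI : Fintype (↥D.Γ ⧸ D.heckeLevel g) := Subgroup.fintypeQuotientOfFiniteIndex
  -- the Hodge model read as a homeomorphism `φ : A.carrier ≃ₜ X(ℂ)`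
  set φ : A.carrier ≃ₜ ComplexPoints X := A.isAnalytification.isHomeomorph.homeomorph with hφ
  have hφc : (⟨A.toComplexPoints, A.isAnalytification.isHomeomorph.continuous⟩ :
      C(A.carrier, ComplexPoints X)) = (φ : C(A.carrier, ComplexPoints X)) := rfl
  -- the level cover `L = N_g \ 𝔹` and the local homeomorphism `pL = φ⁻¹ ∘ π : L → A.carrier`
  have hcov : IsCoveringMap (D.levelProj (D.heckeLevel g)) := h.isCoveringMap
  have hp : IsLocalHomeomorph (φ.symm ∘ D.levelProj (D.heckeLevel g)) :=
    φ.symm.isLocalHomeomorph.comp hcov.isLocalHomeomorph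
  -- the lifted complex structure on `L`
  letI : ChartedSpace A.model (D.LevelCover (D.heckeLevel g)) := liftChartedSpace hp
  haveI : IsManifold 𝓘(ℂ, A.model) ω (D.LevelCover (D.heckeLevel g)) :=
    isManifold_of_atlas_eq_lift 𝓘(ℂ, A.model) ω hp rfl
  haveI : IsManifold 𝓘(ℝ, A.model) ∞ (D.LevelCover (D.heckeLevel g)) :=
    isManifold_of_atlas_eq_lift 𝓘(ℝ, A.model) ∞ hp rfl
  -- `L` and `A.carrier` are compact Hausdorff Kähler (Stubs L1, L3, L4)
  obtain ⟨hLc, hLt⟩ := stub_levelCoverCompactT2 D (D.heckeLevel g) hcov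
  haveI := hLc
  haveI := hLt
  obtain ⟨hMc, hMK⟩ := stub_modelKaehlerCompact D.isSmoothProjective A
  haveI := hMc
  haveI := hMK
  haveI : IsKaehlerManifold A.model (D.LevelCover (D.heckeLevel g)) :=
    stub_levelCoverKaehler D A (D.heckeLevel g) hp hMK
  -- `pL` is holomorphic (identity in the lifted charts) and `pL^*` is injective (transfer)
  have hpL : MDifferentiable 𝓘(ℂ, A.model) 𝓘(ℂ, A.model) (φ.symm ∘ D.levelProj (D.heckeLevel g)) :=
    (contMDiff_proj_of_chartAt_eq (I := 𝓘(ℂ, A.model)) (n := ω) hp fun _ ↦ rfl).mdifferentiable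
      (by simp)
  have hpLc : (⟨φ.symm ∘ D.levelProj (D.heckeLevel g), hpL.continuous⟩ :
      C(D.LevelCover (D.heckeLevel g), A.carrier)) =
        (φ.symm : C(ComplexPoints X, A.carrier)).comp (D.levelProj (D.heckeLevel g)) := rfl
  have hinj : Function.Injective
      (singularCohomology.map ℂ ℂ ⟨φ.symm ∘ D.levelProj (D.heckeLevel g), hpL.continuous⟩ k) := by
    rw [hpLc, singularCohomology.map_comp]
    refine Function.Injective.comp (g := singularCohomology.map ℂ ℂ (D.levelProj (D.heckeLevel g)) k)
      ?_ ?_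
    · exact h.deckCover.map_proj_injective_of_card_ne_zero ℂ
        (Nat.cast_ne_zero.2 Fintype.card_ne_zero) k
    · -- `(φ⁻¹)^*` has the left inverse `φ^*`
      refine Function.HasLeftInverse.injective
        ⟨singularCohomology.map ℂ ℂ (φ : C(A.carrier, ComplexPoints X)) k, fun x ↦ ?_⟩
      change (singularCohomology.map ℂ ℂ (φ.symm : C(ComplexPoints X, A.carrier)) k ≫
        singularCohomology.map ℂ ℂ (φ : C(A.carrier, ComplexPoints X)) k) x = x
      rw [← singularCohomology.map_comp]
      have hid : (φ.symm : C(ComplexPoints X, A.carrier)).comp (φ : C(A.carrier, ComplexPoints X)) =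
          ContinuousMap.id A.carrier := by
        ext x
        exact φ.symm_apply_apply x
      rw [hid, singularCohomology.map_id]
      rfl
  -- Hodge types in `L` and in `A.carrier`, read through `A.deRham`
  set SL : Submodule ℂ (singularCohomology ℂ ℂ (D.LevelCover (D.heckeLevel g)) k) :=
    (hodgePQ A.model (D.LevelCover (D.heckeLevel g)) k p' q').map
      (A.deRham (D.LevelCover (D.heckeLevel g)) k).toLinearMap with hSL
  -- the pull-back of `φ^* β` along a holomorphic branch `F : L → A.carrier` lies in `SL`
  have hbranch : ∀ {F : D.LevelCover (D.heckeLevel g) → A.carrier}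
      (hF : MDifferentiable 𝓘(ℂ, A.model) 𝓘(ℂ, A.model) F),
      singularCohomology.map ℂ ℂ ⟨F, hF.continuous⟩ k (A.pullback k β) ∈ SL := by
    intro F hF
    have hFr : ContMDiff 𝓘(ℝ, A.model) 𝓘(ℝ, A.model) ∞ F := hF.contMDiff_real_of_complex
    obtain ⟨w, hw, hwβ⟩ := Submodule.mem_map.1 hA
    rw [← hwβ]
    change singularCohomology.map ℂ ℂ ⟨F, hFr.continuous⟩ k (A.deRham A.carrier k w) ∈ SL
    rw [← A.deRham_isNatural (D.LevelCover (D.heckeLevel g)) A.carrier F hFr k w]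
    exact Submodule.mem_map_of_mem (map_mem_hodgePQ hFr hF hw)
  -- `pL^* (φ^* T_g β) = π^* (T_g β) = [Γ':N]⁻¹ Σ_q (π_g ∘ q)^* β ∈ SL`
  have hmem : singularCohomology.map ℂ ℂ ⟨φ.symm ∘ D.levelProj (D.heckeLevel g), hpL.continuous⟩ k
      (A.pullback k (D.heckeCorrespondenceAction k g β)) ∈ SL := by
    have step1 : ∀ y : complexBetti X k,
        singularCohomology.map ℂ ℂ ⟨φ.symm ∘ D.levelProj (D.heckeLevel g), hpL.continuous⟩ k
          (A.pullback k y) = singularCohomology.map ℂ ℂ (D.levelProj (D.heckeLevel g)) k y := by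
      intro y
      change (singularCohomology.map ℂ ℂ (φ : C(A.carrier, ComplexPoints X)) k ≫
        singularCohomology.map ℂ ℂ ⟨φ.symm ∘ D.levelProj (D.heckeLevel g), hpL.continuous⟩ k) y = _
      rw [← singularCohomology.map_comp]
      have hmaps : (φ : C(A.carrier, ComplexPoints X)).comp
          ⟨φ.symm ∘ D.levelProj (D.heckeLevel g), hpL.continuous⟩ = D.levelProj (D.heckeLevel g) :=
        ContinuousMap.ext fun ℓ ↦ φ.apply_symm_apply _
      rw [hmaps]
    rw [step1, D.levelProj_map_heckeCorrespondenceAction h k β]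
    refine Submodule.smul_mem _ _ (Submodule.sum_mem _ fun q _ ↦ ?_)
    induction q using QuotientGroup.induction_on with
    | H γ =>
      rw [UnitaryBallQuotientDatum.IsHeckeAdmissible.twist_comp_smul D h γ]
      -- `coverMap (g γ) = φ ∘ (φ⁻¹ ∘ coverMap (g γ))`, a holomorphic branch (Stub L2)
      have hF := stub_coverMapHolomorphic D A (D.heckeLevel g) hp (g * γ)
        (mul_mem h.mem_unitaryGroup (D.isCongruenceSubgroup.1 γ.2)) (fun δ hδ ↦ by
          have h' := D.conj_mem_of_mem_heckeLevel g
            (Subgroup.Normal.conj_mem inferInstance δ hδ γ : γ * δ * γ⁻¹ ∈ D.heckeLevel g)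
          simpa only [Subgroup.coe_mul, InvMemClass.coe_inv, mul_assoc, _root_.mul_inv_rev] using h')
      have hb := hbranch hF
      have hc : (⟨φ.symm ∘ _, hF.continuous⟩ : C(D.LevelCover (D.heckeLevel g), A.carrier)) =
          (φ.symm : C(ComplexPoints X, A.carrier)).comp (D.coverMap (g * γ) _ _) := rfl
      rw [hc, singularCohomology.map_comp] at hb
      change (singularCohomology.map ℂ ℂ (φ : C(A.carrier, ComplexPoints X)) k ≫
        (singularCohomology.map ℂ ℂ (φ.symm : C(ComplexPoints X, A.carrier)) k ≫
          singularCohomology.map ℂ ℂ (D.coverMap (g * γ) _ _) k)) β ∈ SL at hb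
      rwa [← singularCohomology.map_comp, ← singularCohomology.map_comp,
        ← ContinuousMap.comp_assoc, show (φ : C(A.carrier, ComplexPoints X)).comp
            (φ.symm : C(ComplexPoints X, A.carrier)) = ContinuousMap.id (ComplexPoints X) from
          ContinuousMap.ext fun x ↦ φ.apply_symm_apply x, ContinuousMap.id_comp] at hb
  -- descend along the injective `pL^*` (Stub L5)
  exact ⟨A, stub_hodgeTypeDescent A.deRham A.deRham_isNatural hpL k p' q' hinj _ hmem⟩

/-! ## The Hecke algebra preserves Hodge types (from `isOfHodgeType_heckeCorrespondenceAction_analytic`) -/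

/-- **The Hecke algebra preserves every Hodge type**: every element of
`𝓗 = Algebra.adjoin ℂ (range T_g)` maps classes of type `(p, q)` to classes of type `(p, q)` — the
generators do (`isOfHodgeType_heckeCorrespondenceAction_analytic`, unconditional), scalars do, and the
property is stable under sums and products of operators (`Algebra.adjoin_induction`; `H^{p,q}` read in one Hodge
model, `IsOfHodgeType.add`). This is the hypothesis `hH` of `stub_killedBarren` (at `(p,q) = (n,n)`).
[cite: BergeronMillsonMoeglin2016Balls, Part 2 §1.8 and Thm. 61] -/
theorem heckeHodgeType :
    ∀ {m : ℕ} {X : SchemeOver ℂ} (D : UnitaryBallQuotientDatum (2 * (m + 1)) X)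
      {a : Module.End ℂ (complexBetti X (2 * (m + 1)))},
      a ∈ Algebra.adjoin ℂ (Set.range (D.heckeCorrespondenceAction (2 * (m + 1)))) → ∀ {p q : ℕ},
      ∀ x : complexBetti X (2 * (m + 1)), IsOfHodgeType (2 * (m + 1)) X (2 * (m + 1)) p q x →
        IsOfHodgeType (2 * (m + 1)) X (2 * (m + 1)) p q (a x) := by
  intro m X D a ha p q
  induction ha using Algebra.adjoin_induction with
  | mem T hT =>
    obtain ⟨g, rfl⟩ := hT
    exact fun x hx ↦ isOfHodgeType_heckeCorrespondenceAction_analytic D g hx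
  | algebraMap r =>
    intro x hx
    rw [Module.algebraMap_end_apply]
    exact hx.smul r
  | add b b' _ _ ihb ihb' =>
    intro x hx
    rw [LinearMap.add_apply]
    exact (ihb x hx).add D.isSmoothProjective (ihb' x hx)
  | mul b b' _ _ ihb ihb' =>
    intro x hx
    rw [Module.End.mul_apply]
    exact ihb _ (ihb' x hx)

end Summit.HodgeConjecture.HodgeConjecture.Cruxes.OrthogonalEnveloped.PuritySortedHeckeEnvelope

end
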